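import Literature.MathematicalPhysics.QuantumFieldTheory.Balaban1983to89.B9B8KnitNormsTransfer

/-!
# `Balaban1983to89.B9B8KnitNeumannCore` — the (B)-line bond junction, file 7a: THE NEUMANN CORE — [4] Thm 3.3's three global entries pass from
# `Δ_a(U)` to a perturbed operator `Δ_a(U) − E` with `|E|_{(−1)→(−3)}·B₀ ≤ ½` (finite-dimensional fixed point, constant `2B₀`)

statement-level skeleton of published theorems with citation tags; proofs where landed; nothing here is a claim about the
Yang–Mills mass gap

Sub-row G-B8-T2S (unit `lit-balaban-t2s-1`, gen 6), lit-balaban RULING #10 road (d): the dag-n06 periodic Green's function `G_knit = (Δ_knit)⁻¹` is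
reached from def-Y's `G(U) = Δ_a(U)⁻¹` (`Node00.GAY`) through `Δ_knit = Δ_a(U)♯ − E`, `E` the (bounded, small) difference of the two curvature letters and
of the two averaging letters (files 5–6), the `D*D` and Landau sectors agreeing exactly (files 1, 4).  THIS FILE is the operator-theoretic core, free of
the knit: on a finite-dimensional normed space, if `G T = 1 = T G`, `‖Gv‖ ≤ β‖v‖`, `‖Ev‖ ≤ ε‖v‖` and `εβ ≤ ½`, then `T − E` is invertible, its inverse
`G₂` satisfies the FIXED-POINT IDENTITY `G₂v = G(v + EG₂v)` with `‖v + EG₂v‖ ≤ 2‖v‖`, hence `‖G₂v‖ ≤ 2β‖v‖` and every bound `‖S(Gv)‖ ≤ β′‖v‖` for a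
further operator `S` (print: `∇_U`, `Δ_U`) passes to `‖S(G₂v)‖ ≤ 2β′‖v‖` (§1); and the same in def-Y's weighted norms `wNormBY` at a constant-level member
(§2: `|Ψ|₍α₎ = (Lⁿ|c_f|⁻¹)^{−α}·‖Ψ‖_∞`, file 3), giving r05's B-LINE 2 hypotheses `hG0 ∕ hG1 ∕ hG3` for `(Δ_a(U) − E)⁻¹` with constant `2B₀` from the same
three for `G(U)` and `|EA|₍₋₃₎ ≤ ε|A|₍₋₁₎`, `2εB₀ ≤ 1` (§3).  Print: [4] Thm 3.3 p. 399 ((3.47) for G(U)), (3.26)–(3.27) p. 395; [B8] (1.58)–(1.59) p. 86.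
OUR READING (not print's): the smallness `2εB₀ ≤ 1` is the junction's, not a printed condition (RULING #10: «say it in the docstring as OUR READING»).

WHAT IS PROVED (kernel, 0 sorry, theorems only).
* §1 (any finite-dimensional normed `ℂ`-space): `ker_eq_bot_of_small`, ★ `isUnit_sub_of_small` (`T − E` invertible), ★ `inverse_sub_fixedPoint`
  (`G₂v = G(v + E(G₂v))`), ★ `norm_inverse_sub_apply_le` (`‖G₂v‖ ≤ 2β‖v‖`), `norm_add_E_inverse_le` (`‖v + EG₂v‖ ≤ 2‖v‖`), ★ `norm_comp_inverse_sub_le`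
  (`‖S(Gu)‖ ≤ β′‖u‖ ∀u ⟹ ‖S(G₂v)‖ ≤ 2β′‖v‖`).
* §2 (def-Y bond carrier, constant level `n`): ★ `wNormBY_eq_weight_mul_norm` (`|Ψ|₍α₎ = (Lⁿ|c_f|⁻¹)^{−α}·‖Ψ‖`, the sup norm of the finite product).
* §3 (def-Y letters, `𝔸` finite-dimensional): ★★★ `GAY_sub_three_members` — from `IsUnit (deltaAY i parS parB Gp U)`, `hG0 ∕ hG1 ∕ hG3` at constant `B₀` for
  `GAY` (r05's B-LINE 2 shapes = p38's M5.7 outputs) and a perturbation `E` with `|EA|₍₋₃₎ ≤ ε|A|₍₋₁₎`, `0 ≤ ε`, `2εB₀ ≤ 1`: `IsUnit (deltaAY … − E)` and the three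
  members for `Ring.inverse (deltaAY … − E)` at constant `2B₀`.

HONEST SCOPE.  Linear algebra; `E` is abstract here (files 5–6 supply the knit's `E` and its bound); no estimate of [4]∕[B8] is proved; the three `hG`
hypotheses are displayed (p38's M5.7 endpoint supplies them at def-Y's letters).  Count-neutral; nothing continuum ∕ mass gap ∕ Clay — the Yang–Mills mass gap
is NOT proved by any of this.  No `sorry`, no `def`, no `… : Prop` fact, no `instance`, no `notation`.  NEW file; file 3 and r05's toolkit by name.
-/

noncomputable section

namespace Literature.MathematicalPhysics.QuantumFieldTheory.Balaban1983to89.B9B8KnitNeumannCore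

open scoped BigOperators
open Node00
open B6KLevelCensusIndexV1 (KIdx)
open B6GlobalChartV1 (PV blkV1)
open B8ScaledSupNorm (weight)
open B8Ineq159AtLettersY (wNormBY_nonneg wNormBY_le_of_weight_mul_norm_le)
open B9B8KnitNormsTransfer (weight_level_pos weight_level_mul_norm_le_wNormBY wNormBY_le_weight_level_mul)

/-! ## §1 The finite-dimensional Neumann ∕ fixed-point core -/

section Core

variable {V : Type*} [NormedAddCommGroup V] [NormedSpace ℂ V] [FiniteDimensional ℂ V]
variable {T G E : Module.End ℂ V} {β ε : ℝ}

omit [FiniteDimensional ℂ V] in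
/-- `(T − E)v = 0 ⟹ v = 0` when `GT = 1`, `‖G‖ ≤ β`, `‖E‖ ≤ ε`, `εβ ≤ ½`. [cite: Balaban1985BackgroundPropagators, Thm 3.3 p.399, (3.27) p.395 (the inverse exists)] -/
theorem ker_eq_bot_of_small (hGT : ∀ v, G (T v) = v) (hG : ∀ v, ‖G v‖ ≤ β * ‖v‖) (hE : ∀ v, ‖E v‖ ≤ ε * ‖v‖) (hβ : 0 ≤ β)
    (hεβ : ε * β ≤ 1 / 2) : LinearMap.ker (T - E) = ⊥ := by
  rw [LinearMap.ker_eq_bot']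
  intro v hv
  have hTE : T v = E v := sub_eq_zero.1 (by simpa [LinearMap.sub_apply] using hv)
  have hfix : v = G (E v) := by rw [← hTE, hGT]
  have h1 : ‖v‖ ≤ β * (ε * ‖v‖) := by
    calc ‖v‖ = ‖G (E v)‖ := by rw [← hfix]
      _ ≤ β * ‖E v‖ := hG _
      _ ≤ β * (ε * ‖v‖) := mul_le_mul_of_nonneg_left (hE v) hβ
  have h2 : ‖v‖ ≤ (1 / 2) * ‖v‖ := by
    calc ‖v‖ ≤ β * (ε * ‖v‖) := h1
      _ = (ε * β) * ‖v‖ := by ring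
      _ ≤ (1 / 2) * ‖v‖ := mul_le_mul_of_nonneg_right hεβ (norm_nonneg _)
  have h3 : ‖v‖ = 0 := by
    have := norm_nonneg v
    linarith
  exact norm_eq_zero.1 h3

/-- ★ **`T − E` IS INVERTIBLE** (finite dimension: injective ⟹ bijective). [cite: Balaban1985BackgroundPropagators, (3.27) p.395, Thm 3.3 p.399] -/
theorem isUnit_sub_of_small (hGT : ∀ v, G (T v) = v) (hG : ∀ v, ‖G v‖ ≤ β * ‖v‖) (hE : ∀ v, ‖E v‖ ≤ ε * ‖v‖) (hβ : 0 ≤ β)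
    (hεβ : ε * β ≤ 1 / 2) : IsUnit (T - E) :=
  (LinearMap.isUnit_iff_ker_eq_bot _).2 (ker_eq_bot_of_small hGT hG hE hβ hεβ)

omit [FiniteDimensional ℂ V] in
/-- ★ **THE FIXED-POINT IDENTITY** of the inverse `G₂ = (T − E)⁻¹`: `G₂v = G(v + E(G₂v))`. [cite: Balaban1985BackgroundPropagators, (3.27) p.395; Balaban1985RegularSpaces, (1.58) p.86 (A = G(U)(…))] -/
theorem inverse_sub_fixedPoint (hU : IsUnit (T - E)) (hGT : ∀ v, G (T v) = v) (v : V) :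
    Ring.inverse (T - E) v = G (v + E (Ring.inverse (T - E) v)) := by
  set w := Ring.inverse (T - E) v with hw
  have hsol : (T - E) w = v := by
    have h := congrArg (fun S : Module.End ℂ V => S v) (Ring.mul_inverse_cancel _ hU)
    simpa only [Module.End.mul_apply, Module.End.one_apply] using h
  have hT : T w = v + E w := by
    rw [LinearMap.sub_apply] at hsol
    rw [← hsol, sub_add_cancel]
  rw [← hT, hGT]

omit [FiniteDimensional ℂ V] in
/-- ★ **`‖G₂v‖ ≤ 2β‖v‖`**. [cite: Balaban1985BackgroundPropagators, Thm 3.3 p.399 ((3.47), n = 0)] -/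
theorem norm_inverse_sub_apply_le (hU : IsUnit (T - E)) (hGT : ∀ v, G (T v) = v) (hG : ∀ v, ‖G v‖ ≤ β * ‖v‖)
    (hE : ∀ v, ‖E v‖ ≤ ε * ‖v‖) (hβ : 0 ≤ β) (hεβ : ε * β ≤ 1 / 2) (v : V) :
    ‖Ring.inverse (T - E) v‖ ≤ 2 * β * ‖v‖ := by
  set w := Ring.inverse (T - E) v with hw
  have h1 : ‖w‖ ≤ β * ‖v‖ + (ε * β) * ‖w‖ := by
    calc ‖w‖ = ‖G (v + E w)‖ := by rw [hw, ← inverse_sub_fixedPoint hU hGT v]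
      _ ≤ β * ‖v + E w‖ := hG _
      _ ≤ β * (‖v‖ + ‖E w‖) := mul_le_mul_of_nonneg_left (norm_add_le _ _) hβ
      _ ≤ β * (‖v‖ + ε * ‖w‖) := mul_le_mul_of_nonneg_left (add_le_add_right (hE w) _) hβ
      _ = β * ‖v‖ + (ε * β) * ‖w‖ := by ring
  have h2 : (ε * β) * ‖w‖ ≤ (1 / 2) * ‖w‖ := mul_le_mul_of_nonneg_right hεβ (norm_nonneg _)
  linarith

omit [FiniteDimensional ℂ V] in
/-- `‖v + E(G₂v)‖ ≤ 2‖v‖`. [cite: Balaban1985BackgroundPropagators, Thm 3.3 p.399, bookkeeping] -/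
theorem norm_add_E_inverse_le (hU : IsUnit (T - E)) (hGT : ∀ v, G (T v) = v) (hG : ∀ v, ‖G v‖ ≤ β * ‖v‖)
    (hE : ∀ v, ‖E v‖ ≤ ε * ‖v‖) (hβ : 0 ≤ β) (hε : 0 ≤ ε) (hεβ : ε * β ≤ 1 / 2) (v : V) :
    ‖v + E (Ring.inverse (T - E) v)‖ ≤ 2 * ‖v‖ := by
  have hw := norm_inverse_sub_apply_le hU hGT hG hE hβ hεβ v
  calc ‖v + E (Ring.inverse (T - E) v)‖ ≤ ‖v‖ + ‖E (Ring.inverse (T - E) v)‖ := norm_add_le _ _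
    _ ≤ ‖v‖ + ε * ‖Ring.inverse (T - E) v‖ := add_le_add_right (hE _) _
    _ ≤ ‖v‖ + ε * (2 * β * ‖v‖) := add_le_add_right (mul_le_mul_of_nonneg_left hw hε) _
    _ = (1 + 2 * (ε * β)) * ‖v‖ := by ring
    _ ≤ 2 * ‖v‖ := by
        refine mul_le_mul_of_nonneg_right ?_ (norm_nonneg _)
        linarith

omit [FiniteDimensional ℂ V] in
/-- ★ **DERIVATIVE ENTRIES PASS**: a bound `‖S(Gu)‖ ≤ β′‖u‖` for every `u` (print: `S = ∇_U`, `Δ_U`) gives `‖S(G₂v)‖ ≤ 2β′‖v‖`.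
[cite: Balaban1985BackgroundPropagators, Thm 3.3 p.399 ((3.47), n = 1, 3)] -/
theorem norm_comp_inverse_sub_le {W : Type*} [SeminormedAddCommGroup W] (S : V → W) {β' : ℝ} (hS : ∀ u, ‖S (G u)‖ ≤ β' * ‖u‖) (hβ' : 0 ≤ β')
    (hU : IsUnit (T - E)) (hGT : ∀ v, G (T v) = v) (hG : ∀ v, ‖G v‖ ≤ β * ‖v‖) (hE : ∀ v, ‖E v‖ ≤ ε * ‖v‖) (hβ : 0 ≤ β) (hε : 0 ≤ ε)
    (hεβ : ε * β ≤ 1 / 2) (v : V) : ‖S (Ring.inverse (T - E) v)‖ ≤ 2 * β' * ‖v‖ := by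
  rw [inverse_sub_fixedPoint hU hGT v]
  calc ‖S (G (v + E (Ring.inverse (T - E) v)))‖ ≤ β' * ‖v + E (Ring.inverse (T - E) v)‖ := hS _
    _ ≤ β' * (2 * ‖v‖) := mul_le_mul_of_nonneg_left (norm_add_E_inverse_le hU hGT hG hE hβ hε hεβ v) hβ'
    _ = 2 * β' * ‖v‖ := by ring

end Core

/-! ## §2 def-Y's weighted norm at a constant-level member IS a multiple of the sup norm -/

section Weighted

variable {d ℓ : ℕ} {hd : 1 ≤ d + 1} {hL : Odd (ℓ + 1) ∧ 1 < ℓ + 1} {b₀ b₁ : ℝ}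
variable {𝔸 : Type} [NormedRing 𝔸] [NormedAlgebra ℂ 𝔸] [CompleteSpace 𝔸]
variable (i : KIdx d ℓ hd hL b₀ b₁) {n : ℕ}

omit [NormedAlgebra ℂ 𝔸] [CompleteSpace 𝔸] in
/-- ★ **`|Ψ|₍α₎ = (Lⁿ|c_f|⁻¹)^{−α}·‖Ψ‖`** at a constant-level member (`‖Ψ‖` the sup norm of the finite product `FBondY i → 𝔸`).
[cite: Balaban1985BackgroundPropagators, (3.41) p.397; Balaban1985RegularSpaces, p.86 (definition after (1.55))] -/
theorem wNormBY_eq_weight_mul_norm (hlev : ∀ z : SiteY i, levY i z = n) (α : ℝ) (Ψ : FBondY i → 𝔸) :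
    wNormBY i α Ψ = weight (ℓ + 1) |i.cf|⁻¹ α n * ‖Ψ‖ := by
  refine le_antisymm (wNormBY_le_weight_level_mul i hlev (norm_nonneg Ψ) fun x => norm_le_pi_norm Ψ x) ?_
  have hw := weight_level_pos i α n
  rw [← le_div_iff₀' hw]
  refine (pi_norm_le_iff_of_nonneg (div_nonneg (wNormBY_nonneg i α Ψ) hw.le)).2 fun x => ?_
  rw [le_div_iff₀' hw]
  exact weight_level_mul_norm_le_wNormBY i hlev α Ψ x

end Weighted

/-! ## §3 The three members of [4] Thm 3.3 ∕ [B8] (1.59) pass from `G(U) = Δ_a(U)⁻¹` to `(Δ_a(U) − E)⁻¹` -/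

section Members

variable {d ℓ : ℕ} {hd : 1 ≤ d + 1} {hL : Odd (ℓ + 1) ∧ 1 < ℓ + 1} {b₀ b₁ : ℝ}
variable {𝔸 : Type} [NormedRing 𝔸] [NormedAlgebra ℂ 𝔸] [CompleteSpace 𝔸] [FiniteDimensional ℂ 𝔸]
variable (i : KIdx d ℓ hd hL b₀ b₁) {n : ℕ}

/-- ★★★ **THE NEUMANN JUNCTION AT def-Y's LETTERS.**  At a constant-level member, let `Δ_a(U) = deltaAY i parS parB Gp U` be invertible with
`G(U) = GAY i parS parB Gp U` satisfying the three (3.47)_{γ=−3} members of B-LINE 2 at constant `B₀` (`|GF|₍₋₁₎`, `|∇_νGF|₍₋₂₎`, `|Δ GF|₍₋₃₎ ≤ B₀|F|₍₋₃₎`),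
and let `E` be a bond operator with `|EA|₍₋₃₎ ≤ ε|A|₍₋₁₎`, `0 ≤ ε`, `2εB₀ ≤ 1`.  Then `Δ_a(U) − E` is invertible and its inverse satisfies the same three
members at constant `2B₀`.  (OUR READING: the smallness `2εB₀ ≤ 1` is the junction's.)
[cite: Balaban1985BackgroundPropagators, Thm 3.3 p.399, (3.47) p.398, (3.26)–(3.27) p.395; Balaban1985RegularSpaces, (1.58)–(1.59) p.86] -/
theorem GAY_sub_three_members (hlev : ∀ z : SiteY i, levY i z = n) (parS : SiteParY 𝔸 i) (parB : BondParY 𝔸 i) (Gp : SiteOpY 𝔸 i)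
    (U : CfgY 𝔸 i) (hΔ : IsUnit (deltaAY i parS parB Gp U)) {B₀ ε : ℝ} (hB₀ : 0 ≤ B₀) (hε : 0 ≤ ε) (hεB : 2 * ε * B₀ ≤ 1)
    (hG0 : ∀ F, wNormBY i (-1) (GAY i parS parB Gp U F) ≤ B₀ * wNormBY i (-3) F)
    (hG1 : ∀ F ν, wNormBY i (-2) (cdB i U ν (GAY i parS parB Gp U F)) ≤ B₀ * wNormBY i (-3) F)
    (hG3 : ∀ F, wNormBY i (-3) (lapB i U (GAY i parS parB Gp U F)) ≤ B₀ * wNormBY i (-3) F)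
    (E : Module.End ℂ (FBondY i → 𝔸)) (hE : ∀ A, wNormBY i (-3) (E A) ≤ ε * wNormBY i (-1) A) :
    IsUnit (deltaAY i parS parB Gp U - E) ∧
      (∀ F, wNormBY i (-1) (Ring.inverse (deltaAY i parS parB Gp U - E) F) ≤ 2 * B₀ * wNormBY i (-3) F) ∧
      (∀ F ν, wNormBY i (-2) (cdB i U ν (Ring.inverse (deltaAY i parS parB Gp U - E) F)) ≤ 2 * B₀ * wNormBY i (-3) F) ∧
      (∀ F, wNormBY i (-3) (lapB i U (Ring.inverse (deltaAY i parS parB Gp U - E) F)) ≤ 2 * B₀ * wNormBY i (-3) F) := by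
  -- the weights
  set w₁ := weight (ℓ + 1) |i.cf|⁻¹ (-1) n with hw₁
  set w₂ := weight (ℓ + 1) |i.cf|⁻¹ (-2) n with hw₂
  set w₃ := weight (ℓ + 1) |i.cf|⁻¹ (-3) n with hw₃
  have hw₁p : 0 < w₁ := weight_level_pos i _ n
  have hw₂p : 0 < w₂ := weight_level_pos i _ n
  have hw₃p : 0 < w₃ := weight_level_pos i _ n
  have hN : ∀ (α : ℝ) (Ψ : FBondY i → 𝔸), wNormBY i α Ψ = weight (ℓ + 1) |i.cf|⁻¹ α n * ‖Ψ‖ := fun α Ψ => wNormBY_eq_weight_mul_norm i hlev α Ψ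
  -- the hypotheses in sup-norm currency
  set T := deltaAY i parS parB Gp U with hT
  set G := GAY i parS parB Gp U with hG
  have hGT : ∀ v, G (T v) = v := fun v => by
    have h := congrArg (fun S : Module.End ℂ (FBondY i → 𝔸) => S v) (Ring.inverse_mul_cancel _ hΔ)
    simp only [Module.End.mul_apply, Module.End.one_apply] at h
    exact h
  have hGsup : ∀ v, ‖G v‖ ≤ (B₀ * w₃ / w₁) * ‖v‖ := fun v => by
    have h := hG0 v
    rw [hN, hN] at h
    have h' : w₁ * ‖G v‖ ≤ B₀ * (w₃ * ‖v‖) := h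
    rw [div_mul_eq_mul_div, le_div_iff₀ hw₁p]
    calc ‖G v‖ * w₁ = w₁ * ‖G v‖ := mul_comm _ _
      _ ≤ B₀ * (w₃ * ‖v‖) := h'
      _ = B₀ * w₃ * ‖v‖ := by ring
  have hEsup : ∀ v, ‖E v‖ ≤ (ε * w₁ / w₃) * ‖v‖ := fun v => by
    have h := hE v
    rw [hN, hN] at h
    have : w₃ * ‖E v‖ ≤ ε * (w₁ * ‖v‖) := h
    rw [div_mul_eq_mul_div, le_div_iff₀ hw₃p]
    calc ‖E v‖ * w₃ = w₃ * ‖E v‖ := mul_comm _ _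
      _ ≤ ε * (w₁ * ‖v‖) := this
      _ = ε * w₁ * ‖v‖ := by ring
  have hβ : 0 ≤ B₀ * w₃ / w₁ := by positivity
  have hε' : 0 ≤ ε * w₁ / w₃ := by positivity
  have hεβ : (ε * w₁ / w₃) * (B₀ * w₃ / w₁) ≤ 1 / 2 := by
    have : (ε * w₁ / w₃) * (B₀ * w₃ / w₁) = ε * B₀ := by field_simp
    rw [this]
    linarith
  have hU : IsUnit (T - E) := isUnit_sub_of_small hGT hGsup hEsup hβ hεβ
  refine ⟨hU, fun F => ?_, fun F ν => ?_, fun F => ?_⟩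
  · -- n = 0
    have h := norm_inverse_sub_apply_le hU hGT hGsup hEsup hβ hεβ F
    rw [hN, hN]
    calc w₁ * ‖Ring.inverse (T - E) F‖ ≤ w₁ * (2 * (B₀ * w₃ / w₁) * ‖F‖) := mul_le_mul_of_nonneg_left h hw₁p.le
      _ = 2 * B₀ * (w₃ * ‖F‖) := by field_simp
  · -- n = 1
    have hS : ∀ u, ‖cdB i U ν (G u)‖ ≤ (B₀ * w₃ / w₂) * ‖u‖ := fun u => by
      have h := hG1 u ν
      rw [hN, hN] at h
      have : w₂ * ‖cdB i U ν (G u)‖ ≤ B₀ * (w₃ * ‖u‖) := h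
      rw [div_mul_eq_mul_div, le_div_iff₀ hw₂p]
      calc ‖cdB i U ν (G u)‖ * w₂ = w₂ * ‖cdB i U ν (G u)‖ := mul_comm _ _
        _ ≤ B₀ * (w₃ * ‖u‖) := this
        _ = B₀ * w₃ * ‖u‖ := by ring
    have h := norm_comp_inverse_sub_le (fun Ψ => cdB i U ν Ψ) hS (by positivity) hU hGT hGsup hEsup hβ hε' hεβ F
    rw [hN, hN]
    calc w₂ * ‖cdB i U ν (Ring.inverse (T - E) F)‖ ≤ w₂ * (2 * (B₀ * w₃ / w₂) * ‖F‖) := mul_le_mul_of_nonneg_left h hw₂p.le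
      _ = 2 * B₀ * (w₃ * ‖F‖) := by field_simp
  · -- n = 3
    have hS : ∀ u, ‖lapB i U (G u)‖ ≤ (B₀ * w₃ / w₃) * ‖u‖ := fun u => by
      have h := hG3 u
      rw [hN, hN] at h
      have : w₃ * ‖lapB i U (G u)‖ ≤ B₀ * (w₃ * ‖u‖) := h
      rw [div_mul_eq_mul_div, le_div_iff₀ hw₃p]
      calc ‖lapB i U (G u)‖ * w₃ = w₃ * ‖lapB i U (G u)‖ := mul_comm _ _
        _ ≤ B₀ * (w₃ * ‖u‖) := this
        _ = B₀ * w₃ * ‖u‖ := by ring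
    have h := norm_comp_inverse_sub_le (fun Ψ => lapB i U Ψ) hS (by positivity) hU hGT hGsup hEsup hβ hε' hεβ F
    rw [hN, hN]
    calc w₃ * ‖lapB i U (Ring.inverse (T - E) F)‖ ≤ w₃ * (2 * (B₀ * w₃ / w₃) * ‖F‖) := mul_le_mul_of_nonneg_left h hw₃p.le
      _ = 2 * B₀ * (w₃ * ‖F‖) := by field_simp

end Members

end Literature.MathematicalPhysics.QuantumFieldTheory.Balaban1983to89.B9B8KnitNeumannCore
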